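import Literature.NumberTheory.Sieve.IwaniecAlmostPrimesQuadraticFundDomain
import Literature.NumberTheory.Sieve.IwaniecAlmostPrimesRootExpSum
import HarnessLib

/-!
# Iwaniec (1978) for a general quadratic: the phase `e(hΘ/D)` in representation coordinates and the congruence conditions — PROVED

H. Iwaniec, *Almost-primes represented by quadratic polynomials*, Invent. Math. **47** (1978)
171–188, §4 p. 180: for `n² + 1`, Lemma 5 (`mq = r² + s²`, `Ω ≡ −r s̄`) turns `e(hΩ/(mq))`
into the Kloosterman phase `e(h r̄/s)` times the slowly varying `e(−hr/(s(r² + s²)))`, and the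
side conditions of Lemma 4 (`l ∣ m`, `m ≡ μ (mod d)`, `Ω ≡ ω (mod d)`) into congruences on `r`
modulo `lqd`.  This file proves the same two facts for a general `G = aX² + bX + c` in the
coordinates of `IwaniecAlmostPrimesQuadraticRootsForms.lean` (admissible representations
`v = (u, s)` of `n = aD` by a form `Φ = (A, B, C)` of discriminant `Δ = b² − 4ac`):

* `ellOf_mul_snd` — Gauss's composition identity `ℓ s = 2n α − (2Au + Bs)` for the Bezout
  completion `uα + sβ = 1` (so `α ≡ ū (mod s)`);
* `fourierChar_thetaOf_div_eq` — **the phase formula**: for `s ≥ 1`,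
  `e(h Θ_Φ(v)/D) = e(h ū/s) · e(−h[(2Au + Bs)/(2sn) + b/(2n)])`, `D = n/a`, `ū = (u mod s)⁻¹`
  (the first factor is the tree's `hooleyPhase h s u`, the second is `twistG`);
* `perG`, `perG_congr` — the conditions "`aql ∣ Φ(u, s)`" (`l ∣ m`), "`Φ(u,s) ≡ aqμ (mod aqd)`"
  (`m ≡ μ (mod d)`) and "`ℓ ≡ 2aω + b (mod 2ad)`" (`Θ ≡ ω (mod d)` together with admissibility)
  depend, for `u` prime to `s`, only on `u` modulo `Λ = 2alqd` (the transport lemma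
  `act_b_modEq_of_modEq`);
* `isAdmRep_of_perG`, `perG_of_isAdmRep` — the dictionary between these conditions and the
  family of Lemma 4 (`n = a·m·q`, `l ∣ m`, `m ≡ μ (mod d)`, `Θ ≡ ω (mod d)`).

Everything here is PROVED; no named facts are introduced.

## References

* H. Iwaniec, Invent. Math. 47 (1978) 171–188, §4 pp. 179–180 (`IwaniecInventiones1978`).
* D. A. Cox, *Primes of the form x² + ny²*, 2nd ed. (2013), §2.A Lemma 2.5 (`Cox2013`).
-/

noncomputable section

open Real
open scoped FourierTransform

namespace Literature.NumberTheory.Sieve.Iwaniec1978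

open Literature.NumberTheory.QuadraticFields.Quadratic
open Literature.NumberTheory.QuadraticFields.Quadratic.BinQF
open Literature.NumberTheory.Sieve.FejerCounting (fourierChar_add_intCast)
open Literature.NumberTheory.Sieve.Vinogradov (norm_fourierChar)
open scoped MatrixGroups

/-! ### Gauss's composition identity and the phase formula -/

/-- **`ℓ s = 2 Φ(u,s) α − (2Au + Bs)`** for the Bezout completion `uα + sβ = 1` used by
`ellOf` (`α = gcdA u s`). [cite: Cox2013, §2.A (Lemma 2.5)] -/
theorem ellOf_mul_snd (Φ : BinQF) {u s : ℤ} (h : IsCoprime u s) :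
    ellOf Φ u s * s = 2 * Φ.eval u s * Int.gcdA u s - (2 * Φ.a * u + Φ.b * s) := by
  have hb : u * Int.gcdA u s + s * Int.gcdB u s = 1 := by
    have := Int.gcd_eq_gcd_ab u s
    rw [Int.isCoprime_iff_gcd_eq_one.mp h] at this
    push_cast at this
    linear_combination -this
  simp only [ellOf, BinQF.act, BinQF.eval]
  linear_combination (-(2 * Φ.a * u + Φ.b * s)) * hb

/-- `α = gcdA u s` is the inverse of `u` modulo `s`. [folklore] -/
theorem gcdA_eq_inv {u : ℤ} {s : ℕ} (h : IsCoprime u (s : ℤ)) :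
    (Int.gcdA u s : ZMod s) = (u : ZMod s)⁻¹ := by
  have hb : u * Int.gcdA u s + s * Int.gcdB u s = 1 := by
    have := Int.gcd_eq_gcd_ab u s
    rw [Int.isCoprime_iff_gcd_eq_one.mp h] at this
    push_cast at this
    linear_combination -this
  have hunit : IsUnit (u : ZMod s) := by
    rw [ZMod.coe_int_isUnit_iff_isCoprime]; exact h.symm
  have h1 : (u : ZMod s) * (Int.gcdA u s : ZMod s) = 1 := by
    have := congrArg (Int.cast : ℤ → ZMod s) hb
    push_cast at this
    rw [ZMod.natCast_self, zero_mul, add_zero] at this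
    exact this
  calc (Int.gcdA u s : ZMod s) = (u : ZMod s)⁻¹ * ((u : ZMod s) * (Int.gcdA u s : ZMod s)) := by
        rw [← mul_assoc, ZMod.inv_mul_of_unit _ hunit, one_mul]
    _ = (u : ZMod s)⁻¹ := by rw [h1, mul_one]

variable {a b c : ℤ}

/-- The slowly varying factor `e(−h[(2Au + Bs)/(2 s n) + b/(2n)])`, `n = Φ(u, s)` (the general
form of the twist `e(−hr/(s(r² + s²)))` of the `n² + 1` case, where `A = 1`, `B = b = 0`).
[cite: IwaniecInventiones1978, §4 p. 180] -/
def twistG (b : ℤ) (Φ : BinQF) (h : ℤ) (s : ℕ) (u : ℤ) : ℂ :=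
  (𝐞 (-((h : ℝ) * ((2 * Φ.a * u + Φ.b * s) / (2 * s * (Φ.eval u s : ℝ)) +
    (b : ℝ) / (2 * (Φ.eval u s : ℝ))))) : ℂ)

/-- `‖twistG‖ = 1`. [folklore] -/
theorem norm_twistG (b : ℤ) (Φ : BinQF) (h : ℤ) (s : ℕ) (u : ℤ) : ‖twistG b Φ h s u‖ = 1 :=
  norm_fourierChar _

/-- **The phase formula.** For an admissible representation `v = (u, s)`, `s ≥ 1`, of `n ≠ 0` by
`Φ` (relative to `G = aX² + bX + c`, `a ≠ 0`), with `D = n/a`: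
`e(h Θ_Φ(v)/D) = e(h ū/s) · e(−h[(2Au + Bs)/(2sn) + b/(2n)])` — from `ℓ s = 2nα − (2Au + Bs)`,
`2aΘ + b = ℓ` and `α ≡ ū (mod s)`. [cite: IwaniecInventiones1978, §4 p. 180] -/
theorem fourierChar_thetaOf_div_eq (ha : a ≠ 0) {Φ : BinQF} {n : ℤ} (hn : n ≠ 0) {u : ℤ}
    {s : ℕ} (hs : 0 < s) (hv : IsAdmRep a b Φ n (u, (s : ℤ))) (h : ℤ) :
    (𝐞 ((h : ℝ) * (thetaOf a b Φ (u, (s : ℤ)) : ℝ) / ((n : ℝ) / a)) : ℂ) =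
      hooleyPhase h s u * twistG b Φ h s u := by
  haveI : NeZero s := ⟨hs.ne'⟩
  have hcop : IsCoprime u (s : ℤ) := hv.coprime
  -- `2aΘ + b = ℓ` and `ℓ s = 2nα − (2Au + Bs)`
  have hΘ := two_mul_a_mul_thetaOf hv
  have hℓ := ellOf_mul_snd Φ hcop
  simp only at hΘ hℓ
  rw [hv.eval_eq] at hℓ
  -- `α = ū + s k`
  set ubar : ℕ := ((u : ZMod s)⁻¹).val with hubar
  have hαu : (s : ℤ) ∣ Int.gcdA u s - ubar := by
    rw [← ZMod.intCast_eq_intCast_iff_dvd_sub]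
    push_cast
    rw [hubar, ZMod.natCast_zmod_val, gcdA_eq_inv hcop]
  obtain ⟨k, hk⟩ := hαu
  have ha' : (a : ℝ) ≠ 0 := by exact_mod_cast ha
  have hn' : (n : ℝ) ≠ 0 := by exact_mod_cast hn
  have hs' : (s : ℝ) ≠ 0 := by exact_mod_cast hs.ne'
  have hΘR : (thetaOf a b Φ (u, (s : ℤ)) : ℝ) = ((ellOf Φ u s : ℝ) - b) / (2 * a) := by
    have : (2 * a * thetaOf a b Φ (u, (s : ℤ)) + b : ℝ) = ellOf Φ u s := by exact_mod_cast hΘ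
    field_simp
    linarith
  have hℓR : (ellOf Φ u s : ℝ) = (2 * n * (Int.gcdA u s : ℝ) - (2 * Φ.a * u + Φ.b * s)) / s := by
    have : (ellOf Φ u s * s : ℝ) = 2 * n * Int.gcdA u s - (2 * Φ.a * u + Φ.b * s) := by
      exact_mod_cast hℓ
    field_simp
    linarith
  have hαR : (Int.gcdA u s : ℝ) = ubar + s * k := by
    have : ((Int.gcdA u s - ubar : ℤ) : ℝ) = ((s * k : ℤ) : ℝ) := by rw [hk]
    push_cast at this
    linarith
  have harg : (h : ℝ) * (thetaOf a b Φ (u, (s : ℤ)) : ℝ) / ((n : ℝ) / a) =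
      (h : ℝ) * ubar / s + -((h : ℝ) * ((2 * Φ.a * u + Φ.b * s) / (2 * s * (n : ℝ)) +
        (b : ℝ) / (2 * (n : ℝ)))) + ((h * k : ℤ) : ℝ) := by
    rw [hΘR, hℓR, hαR]
    push_cast
    field_simp
    ring
  rw [harg, fourierChar_add_intCast, AddChar.map_add_eq_mul, Circle.coe_mul]
  congr 1
  · rw [fourierChar_eq_exp, hooleyPhase]
    congr 1
    push_cast
    ring
  · rw [twistG, hv.eval_eq]

/-! ### The congruence conditions of Lemma 4 in representation coordinates -/

/-- The side conditions for fixed `s`, as conditions on `u`: `aql ∣ Φ(u, s)` (the modulus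
`n = Φ(u,s)` is `a·m·q` with `l ∣ m`), `Φ(u, s) ≡ aqμ (mod aqd)` (`m ≡ μ (mod d)`), and
`ℓ ≡ 2aω + b (mod 2ad)` (admissibility and `Θ ≡ ω (mod d)`).
[cite: IwaniecInventiones1978, §4 p. 180] -/
def perG (a b : ℤ) (Φ : BinQF) (q l d μ ω : ℕ) (s : ℕ) (u : ℤ) : Prop :=
  (a * q * l : ℤ) ∣ Φ.eval u s ∧ Φ.eval u s ≡ a * q * μ [ZMOD a * q * d] ∧
    ellOf Φ u s ≡ 2 * a * ω + b [ZMOD 2 * a * d]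

/-- Values of a form are congruent at congruent arguments. [folklore] -/
theorem eval_modEq_of_modEq (Φ : BinQF) {u u' s M : ℤ} (h : u ≡ u' [ZMOD M]) :
    Φ.eval u s ≡ Φ.eval u' s [ZMOD M] := by
  simp only [BinQF.eval]
  exact ((h.pow 2).mul_left _).add ((h.mul_left _).mul_right _) |>.add (Int.ModEq.refl _)

/-- **Periodicity of the side conditions**: for `a > 0`, `d ∣ q`, and `u, u'` prime to `s` with
`u ≡ u' (mod 2alqd)`, `perG … u ↔ perG … u'`. [cite: IwaniecInventiones1978, §4 p. 180] -/
theorem perG_congr (ha : 0 < a) {Φ : BinQF} {q l d μ ω s : ℕ} (hdq : d ∣ q) {u u' : ℤ}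
    (hu : IsCoprime u (s : ℤ)) (hu' : IsCoprime u' (s : ℤ))
    (hmod : u ≡ u' [ZMOD 2 * a * l * q * d]) :
    perG a b Φ q l d μ ω s u ↔ perG a b Φ q l d μ ω s u' := by
  -- one direction suffices
  suffices key : ∀ u u' : ℤ, IsCoprime u (s : ℤ) → IsCoprime u' (s : ℤ) →
      u ≡ u' [ZMOD 2 * a * l * q * d] → perG a b Φ q l d μ ω s u → perG a b Φ q l d μ ω s u' from
    ⟨key u u' hu hu' hmod, key u' u hu' hu hmod.symm⟩
  clear! u u'
  intro u u' hu hu' hmod ⟨h1, h2, h3⟩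
  obtain ⟨e, he⟩ := hdq
  have hΦ1 : Φ.eval u s ≡ Φ.eval u' s [ZMOD a * q * l] :=
    eval_modEq_of_modEq Φ (hmod.of_dvd ⟨2 * d, by ring⟩)
  have hΦ2 : Φ.eval u s ≡ Φ.eval u' s [ZMOD a * q * d] :=
    eval_modEq_of_modEq Φ (hmod.of_dvd ⟨2 * l, by ring⟩)
  refine ⟨Int.modEq_zero_iff_dvd.mp (hΦ1.symm.trans (Int.modEq_zero_iff_dvd.mpr h1)),
    hΦ2.symm.trans h2, ?_⟩
  -- the transport lemma with `M = 2ad`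
  · have hdet : u * Int.gcdA u s - -Int.gcdB u s * s = 1 := by
      have := Int.gcd_eq_gcd_ab u s
      rw [Int.isCoprime_iff_gcd_eq_one.mp hu] at this
      push_cast at this
      linear_combination -this
    have hdet' : u' * Int.gcdA u' s - -Int.gcdB u' s * s = 1 := by
      have := Int.gcd_eq_gcd_ab u' s
      rw [Int.isCoprime_iff_gcd_eq_one.mp hu'] at this
      push_cast at this
      linear_combination -this
    set M : ℕ := (2 * a * d).toNat with hM
    have hMeq : (M : ℤ) = 2 * a * d := Int.toNat_of_nonneg (by positivity)
    have hM2 : (M : ℤ) ∣ 2 * Φ.eval u s := by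
      rw [hMeq]
      have : (a * q : ℤ) ∣ Φ.eval u s := (dvd_mul_right _ _).trans h1 |> fun h => by
        exact (Dvd.intro _ rfl : (a * q : ℤ) ∣ a * q * l).trans h1
      obtain ⟨t, ht⟩ := this
      exact ⟨t * e, by rw [ht, he]; push_cast; ring⟩
    have humod : u' ≡ u [ZMOD M] := by
      rw [hMeq]; exact (hmod.of_dvd ⟨l * q, by ring⟩).symm
    have htr := act_b_modEq_of_modEq Φ hdet (by rw [hdet']) humod (Int.ModEq.refl _) hM2
    rw [hMeq] at htr
    -- `htr : ellOf Φ u' s ≡ ellOf Φ u s (mod 2ad)`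
    exact (show ellOf Φ u' s ≡ ellOf Φ u s [ZMOD 2 * a * d] from htr).trans h3

/-- **The dictionary, part 1**: for `u` prime to `s ≥ 1` with `perG`, `v = (u, s)` is an
admissible representation of `n = Φ(u, s)`, `n = a·m·q` with `m = n/(aq)` a positive... an integer
multiple of `l`, `m ≡ μ (mod d)`, and `Θ_Φ(v) ≡ ω (mod d)`. [cite: IwaniecInventiones1978, §4 p. 180] -/
theorem isAdmRep_of_perG (ha : 0 < a) {Φ : BinQF} {q l d μ ω s : ℕ} (hq : 0 < q) {u : ℤ}
    (hu : IsCoprime u (s : ℤ)) (hper : perG a b Φ q l d μ ω s u) :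
    IsAdmRep a b Φ (Φ.eval u s) (u, (s : ℤ)) ∧
      (∃ m : ℤ, Φ.eval u s = a * (m * q) ∧ (l : ℤ) ∣ m ∧ m ≡ μ [ZMOD d]) ∧
      thetaOf a b Φ (u, (s : ℤ)) ≡ ω [ZMOD d] := by
  obtain ⟨h1, h2, h3⟩ := hper
  have hadm : IsAdmRep a b Φ (Φ.eval u s) (u, (s : ℤ)) :=
    ⟨hu, rfl, (h3.of_dvd ⟨d, by ring⟩).trans (Int.modEq_iff_dvd.mpr ⟨-ω, by ring⟩)⟩
  refine ⟨hadm, ?_, ?_⟩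
  · obtain ⟨t, ht⟩ := h1
    refine ⟨t * l, by rw [ht]; ring, dvd_mul_left _ _, ?_⟩
    -- `a q (t l) ≡ a q μ (mod a q d)` gives `t l ≡ μ (mod d)`
    have h2' : a * q * (t * l) ≡ a * q * μ [ZMOD a * q * d] := by
      have : Φ.eval u s = a * q * (t * l) := by rw [ht]; ring
      rw [← this]; exact h2
    have haq : (a * q : ℤ) ≠ 0 := by positivity
    obtain ⟨w, hw⟩ := Int.modEq_iff_dvd.mp h2'
    refine Int.modEq_iff_dvd.mpr ⟨w, ?_⟩
    have : a * q * (μ - t * l) = a * q * (d * w) := by linear_combination hw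
    exact mul_left_cancel₀ haq this
  · have hΘ := two_mul_a_mul_thetaOf hadm
    simp only at hΘ
    -- `2aΘ + b = ℓ ≡ 2aω + b (mod 2ad)` gives `Θ ≡ ω (mod d)`
    have : 2 * a * thetaOf a b Φ (u, (s : ℤ)) ≡ 2 * a * ω [ZMOD 2 * a * d] := by
      have h3' := h3
      rw [← hΘ] at h3'
      exact Int.ModEq.add_right_cancel' b h3'
    obtain ⟨w, hw⟩ := Int.modEq_iff_dvd.mp this
    refine Int.modEq_iff_dvd.mpr ⟨w, ?_⟩
    have h2a : (2 * a : ℤ) ≠ 0 := by positivity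
    have : 2 * a * (ω - thetaOf a b Φ (u, (s : ℤ))) = 2 * a * (d * w) := by linear_combination hw
    exact mul_left_cancel₀ h2a this

/-- **The dictionary, part 2**: conversely, an admissible representation `v = (u, s)` of
`n = a·m·q` with `l ∣ m`, `m ≡ μ (mod d)` and `Θ_Φ(v) ≡ ω (mod d)` satisfies `perG`.
[cite: IwaniecInventiones1978, §4 p. 180] -/
theorem perG_of_isAdmRep {Φ : BinQF} {q l d μ ω s : ℕ} {u m : ℤ}
    (hv : IsAdmRep a b Φ (a * (m * q)) (u, (s : ℤ))) (hlm : (l : ℤ) ∣ m) (hmμ : m ≡ μ [ZMOD d])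
    (hΘ : thetaOf a b Φ (u, (s : ℤ)) ≡ ω [ZMOD d]) : perG a b Φ q l d μ ω s u := by
  have hev : Φ.eval u s = a * (m * q) := hv.eval_eq
  refine ⟨?_, ?_, ?_⟩
  · rw [hev]
    obtain ⟨t, ht⟩ := hlm
    exact ⟨t, by rw [ht]; ring⟩
  · rw [hev]
    obtain ⟨w, hw⟩ := Int.modEq_iff_dvd.mp hmμ
    exact Int.modEq_iff_dvd.mpr ⟨w, by linear_combination a * q * hw⟩
  · have h2 := two_mul_a_mul_thetaOf hv
    simp only at h2
    rw [← h2]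
    obtain ⟨w, hw⟩ := Int.modEq_iff_dvd.mp hΘ
    exact Int.modEq_iff_dvd.mpr ⟨w, by linear_combination 2 * a * hw⟩

end Literature.NumberTheory.Sieve.Iwaniec1978

end
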